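import Summits.QuantumFields.YangMills.Theorems.UnitScaleTiltProp7IMSDoubleCommutatorPerturbedBlock
import HarnessLib

/-!
# Route `UnitScaleTilt`, crux K1 «MinimiserStabilityRegPr» (stmt-QuantumFields-19200), EX row `hGF` (curved member) — **(L6) slot `hK₂`, ABSTRACT CORE: THE FIRST-ORDER COMMUTATOR OF A
# BLOCK-BILINEARLY BOUNDED KERNEL WITH A PERTURBED BLOCK-LIPSCHITZ CUT-OFF FAMILY** (first-order sibling of ✓`Prop7IMSDoubleCommutatorPerturbedBlock`; ★p1 g24 00:40:07Z slot map)

Cell `ym3-torus` (HUMAN RULING D-0037, rung R3 — NOT d = 4, NOT a mass gap, NOT Clay).  Width seat `ym-ust-19200-w5` (gen 13); chair ★`ym-ust-19200-p1` g24 («hK₂ ← w5»).  THEOREMS ONLY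
(0 `def`, 0 `sorry`); `--supports stmt-QuantumFields-19200 --as helper`.  HONEST LABEL (№33 (6)): LOD-line supplier, CONDITIONAL on the member bricks; nothing of (3.49), `h349`, `hGF`, EX, the crux proved.

THE POINT.  The knit ✓`Prop7LODAssembly.curvedTarget_of_LOD` wants `hK₂ : Σ_j ‖T₂(χ_j•A) − χ′_j•T₂A‖² ≤ κ₂²‖A‖² + μ₂·q_U(A)` for `T₂ = R∘D*`, and
`T₂(χ•A) − χ′•T₂A = R([D*,χ]A) − [P,χ′](D*A)` (`P = 1 − R`): the `D*`-commutator is local (pen (L6-χ)); what is left is the FIRST-ORDER commutator of the nonlocal `P` with the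
cut-off family, summed in squares over the family.  For a kernel `A` with BLOCK bilinear bounds `β(X,Y)` (symmetric, `≥ 0`, moments `Σ_Y dc^m β ≤ S_m`) and cut-offs
`h_b = g_b∘blk + δ_b` (`Σ_b (g_bX − g_bY)² ≤ ℓ²dc(X,Y)²`, `Σ_b δ_b(i)² ≤ ε²`):  `Σ_b ‖[A, h_b•]v‖² ≤ (2ℓ²S₁² + 8ε²S₀²)·‖v‖²`.
Mechanism: `‖[A,ḡ]v‖² = Σ_{X,Y}(g_Y − g_X)·F_{XY}([A,ḡ]v, v)` (the square IS a first-order kernel form), Cauchy–Schwarz in `b`, then the PARAMETRISED Schur∕AM–GM step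
`W² ≤ ℓS₁(tW² + t⁻¹‖v‖²)∕2 ∀ t > 0 ⟹ W² ≤ ℓ²S₁²‖v‖²`; the `δ`-part by `‖Aw‖ ≤ S₀‖w‖` (same trick) and `Σ_b δ_b² ≤ ε²`.

WHAT IS PROVED (ns `…Theorems.Prop7IMSFirstOrderBlockCommutator`; letters of ✓p749039 §5 ∕ ✓p750965).
* §1 reals: `le_sq_mul_of_forall_amgm`, `sum_weighted_prod_le_param` (AM–GM∕Schur with a free parameter `t`).
* §2 kernel bookkeeping: `comm_apply` (`(A(c•v) − c•Av)_i = Σ_k (c_k − c_i)A_{ik}v_k`), `sum_star_mul_self_eq`, ★`normSq_mulVec_le_of_blockBound` (`‖Av‖² ≤ S₀²‖v‖²`).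
* §3 ★★ `sum_normSq_comm_blockConst_le` (`Σ_b ‖[A, (g_b∘blk)•]v‖² ≤ ℓ²S₁²‖v‖²`), §4 ★★ `sum_normSq_comm_diag_le` (`Σ_b ‖[A, δ_b•]v‖² ≤ 4ε²S₀²‖v‖²`),
  §5 ★★★ `sum_normSq_comm_le_of_blockBound_perturbed` (`≤ (2ℓ²S₁² + 8ε²S₀²)‖v‖²`); §6 `sum_sq_sub_le_of_path` (adjacent-step family rows ⟹ `hLip` along paths, `m²·B`).
WHY IT MIGHT FAIL: nothing here; member: `β` for `P = B M⁻¹ Bᴴ` (routeR-w2 B-series) must have K-uniform `S₀, S₁`, and `f = D*A` is paid in the relative currency via ✓p750717.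

References: T. Bałaban, CMP **99** (1985) 389–434 [Balaban1985BackgroundPropagators] ((3.49) p.399, Thm 3.11 p.416); B. Simon, Ann. IHP A **38** (1983) 295–308.
-/

set_option autoImplicit false

noncomputable section

open scoped Matrix ComplexConjugate BigOperators
open Finset

namespace Summit.QuantumFields.YangMills.Theorems.Prop7IMSFirstOrderBlockCommutator

open Summit.QuantumFields.YangMills.Theorems.Prop7IMSDoubleCommutatorDecay (sum_eq_sum_blocks)
open Summit.QuantumFields.YangMills.Theorems.Prop7IMSDoubleCommutatorPerturbedBlock (blockForm_eq_sum_blocks sum_blockCoeff_mul_eq sum_weighted_prod_le sum_normSq_diagMul_block_le)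

variable {n B β : Type*} [Fintype n] [Fintype B] [Fintype β] [DecidableEq β]

/-! ## §1 Two real steps -/

omit [Fintype n] [Fintype B] [Fintype β] [DecidableEq β] in
/-- The parametrised AM–GM absorption: `P ≤ c(tP + t⁻¹Q)∕2` for every `t > 0` (`c ≥ 0`) forces `P ≤ c²Q`. [folklore] -/
theorem le_sq_mul_of_forall_amgm {P Q c : ℝ} (hc : 0 ≤ c) (h : ∀ t : ℝ, 0 < t → P ≤ c * (t * P + t⁻¹ * Q) / 2) : P ≤ c ^ 2 * Q := by
  rcases hc.eq_or_lt with h0 | hpos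
  · have := h 1 one_pos
    rw [← h0] at this ⊢
    simpa using this
  · have := h c⁻¹ (inv_pos.2 hpos)
    rw [inv_inv] at this
    have e : c * (c⁻¹ * P + c * Q) / 2 = P / 2 + c ^ 2 * Q / 2 := by
      rw [mul_add, ← mul_assoc, mul_inv_cancel₀ hpos.ne', one_mul]; ring
    rw [e] at this
    linarith

omit [DecidableEq β] [Fintype n] [Fintype B] in
/-- Schur∕AM–GM over block pairs WITH A PARAMETER: symmetric nonnegative `ω·β` with row sums `≤ S` give `Σ_{X,Y} ωβ·(a_X b_Y) ≤ S·(tΣa² + t⁻¹Σb²)∕2` for every `t > 0`. [folklore] -/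
theorem sum_weighted_prod_le_param (ω βb : β → β → ℝ) (hωs : ∀ X Y, ω X Y = ω Y X) (hβs : ∀ X Y, βb X Y = βb Y X)
    (hω0 : ∀ X Y, 0 ≤ ω X Y) (hβ0 : ∀ X Y, 0 ≤ βb X Y) {S : ℝ} (hS : ∀ X, ∑ Y, ω X Y * βb X Y ≤ S) (a b : β → ℝ) {t : ℝ} (ht : 0 < t) :
    ∑ X, ∑ Y, ω X Y * βb X Y * (a X * b Y) ≤ S * (t * (∑ X, a X ^ 2) + t⁻¹ * ∑ X, b X ^ 2) / 2 := by
  have hst : 0 < Real.sqrt t := Real.sqrt_pos.2 ht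
  have e : ∀ X Y, a X * b Y = (Real.sqrt t * a X) * ((Real.sqrt t)⁻¹ * b Y) := fun X Y => by
    field_simp
  have h := sum_weighted_prod_le ω βb hωs hβs hω0 hβ0 hS (fun X => Real.sqrt t * a X) (fun X => (Real.sqrt t)⁻¹ * b X)
  have e1 : ∑ X, (Real.sqrt t * a X) ^ 2 = t * ∑ X, a X ^ 2 := by
    rw [Finset.mul_sum]; exact Finset.sum_congr rfl fun X _ => by rw [mul_pow, Real.sq_sqrt ht.le]
  have e2 : ∑ X, ((Real.sqrt t)⁻¹ * b X) ^ 2 = t⁻¹ * ∑ X, b X ^ 2 := by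
    rw [Finset.mul_sum]; exact Finset.sum_congr rfl fun X _ => by rw [mul_pow, inv_pow, Real.sq_sqrt ht.le]
  rw [e1, e2] at h
  calc ∑ X, ∑ Y, ω X Y * βb X Y * (a X * b Y)
      = ∑ X, ∑ Y, ω X Y * βb X Y * ((Real.sqrt t * a X) * ((Real.sqrt t)⁻¹ * b Y)) :=
        Finset.sum_congr rfl fun X _ => Finset.sum_congr rfl fun Y _ => by rw [← e X Y]
    _ ≤ S * (t * (∑ X, a X ^ 2) + t⁻¹ * ∑ X, b X ^ 2) / 2 := h

/-! ## §2 Kernel bookkeeping -/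

omit [Fintype B] [Fintype β] [DecidableEq β] in
/-- The commutator of a kernel with a multiplication: `(A(c•v) − c•(Av))_i = Σ_k (c_k − c_i)·A_{ik}v_k`. [folklore] -/
theorem comm_apply (A : Matrix n n ℂ) (c v : n → ℂ) (i : n) :
    (A *ᵥ (fun k => c k * v k)) i - c i * (A *ᵥ v) i = ∑ k, (c k - c i) * (A i k * v k) := by
  simp only [Matrix.mulVec, dotProduct, Finset.mul_sum, ← Finset.sum_sub_distrib]
  exact Finset.sum_congr rfl fun k _ => by ring

omit [Fintype B] [Fintype β] [DecidableEq β] in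
/-- `Σ_i w̄_i w_i = Σ_i ‖w_i‖²` (as a complex number). [folklore] -/
theorem sum_star_mul_self_eq (w : n → ℂ) : ∑ i, star (w i) * w i = (((∑ i, ‖w i‖ ^ 2 : ℝ)) : ℂ) := by
  push_cast
  exact Finset.sum_congr rfl fun i _ => by rw [Complex.star_def, Complex.conj_mul']

omit [Fintype B] in
/-- ★ **OPERATOR BOUND FROM THE BLOCK BILINEAR BOUND**: `Σ_Y β(X,Y) ≤ S₀` (rows; `β` symmetric `≥ 0`) ⟹ `‖Av‖² ≤ S₀²·‖v‖²` (Schur, parametrised AM–GM).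
[cite: Balaban1985BackgroundPropagators, Thm 3.11 p.416] -/
theorem normSq_mulVec_le_of_blockBound (A : Matrix n n ℂ) (blk : n → β)
    (βb : β → β → ℝ) (hβs : ∀ X Y, βb X Y = βb Y X) (hβ0 : ∀ X Y, 0 ≤ βb X Y) {S₀ : ℝ} (hS₀ : 0 ≤ S₀)
    (hA : ∀ (X Y : β) (u w : n → ℂ),
      ‖∑ i ∈ univ.filter (fun i => blk i = X), ∑ k ∈ univ.filter (fun k => blk k = Y), star (u i) * A i k * w k‖
        ≤ βb X Y * Real.sqrt (∑ i ∈ univ.filter (fun i => blk i = X), ‖u i‖ ^ 2) * Real.sqrt (∑ k ∈ univ.filter (fun k => blk k = Y), ‖w k‖ ^ 2))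
    (hS : ∀ X, ∑ Y, βb X Y ≤ S₀) (v : n → ℂ) :
    ∑ i, ‖(A *ᵥ v) i‖ ^ 2 ≤ S₀ ^ 2 * ∑ i, ‖v i‖ ^ 2 := by
  classical
  set u : n → ℂ := A *ᵥ v with hu
  set a : β → ℝ := fun X => Real.sqrt (∑ i ∈ univ.filter (fun i => blk i = X), ‖u i‖ ^ 2) with ha
  set b : β → ℝ := fun X => Real.sqrt (∑ i ∈ univ.filter (fun i => blk i = X), ‖v i‖ ^ 2) with hb
  have ha2 : ∑ X, a X ^ 2 = ∑ i, ‖u i‖ ^ 2 := by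
    rw [sum_eq_sum_blocks blk (fun i => ‖u i‖ ^ 2)]
    exact Finset.sum_congr rfl fun X _ => Real.sq_sqrt (Finset.sum_nonneg fun i _ => sq_nonneg _)
  have hb2 : ∑ X, b X ^ 2 = ∑ i, ‖v i‖ ^ 2 := by
    rw [sum_eq_sum_blocks blk (fun i => ‖v i‖ ^ 2)]
    exact Finset.sum_congr rfl fun X _ => Real.sq_sqrt (Finset.sum_nonneg fun i _ => sq_nonneg _)
  -- `Σ‖u_i‖² = ‖Σ_i ū_i (Av)_i‖ = ‖Σ_i Σ_k ū_i A_ik v_k‖`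
  have hZ : (((∑ i, ‖u i‖ ^ 2 : ℝ)) : ℂ) = ∑ i, ∑ k, star (u i) * A i k * v k := by
    rw [← sum_star_mul_self_eq]
    refine Finset.sum_congr rfl fun i _ => ?_
    rw [hu]
    simp only [Matrix.mulVec, dotProduct, Finset.mul_sum]
    exact Finset.sum_congr rfl fun k _ => by ring
  have hP : ∀ t : ℝ, 0 < t → ∑ i, ‖u i‖ ^ 2 ≤ S₀ * (t * (∑ i, ‖u i‖ ^ 2) + t⁻¹ * ∑ i, ‖v i‖ ^ 2) / 2 := by
    intro t ht
    have h1 : ∑ i, ‖u i‖ ^ 2 = ‖∑ i, ∑ k, star (u i) * A i k * v k‖ := by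
      rw [← hZ, Complex.norm_real, Real.norm_eq_abs, abs_of_nonneg (Finset.sum_nonneg fun i _ => sq_nonneg _)]
    have h2 := sum_weighted_prod_le_param (fun _ _ => (1 : ℝ)) βb (fun _ _ => rfl) hβs (fun _ _ => zero_le_one) hβ0
      (S := S₀) (fun X => by simpa only [one_mul] using hS X) a b ht
    rw [ha2, hb2] at h2
    calc ∑ i, ‖u i‖ ^ 2 = ‖∑ i, ∑ k, star (u i) * A i k * v k‖ := h1
      _ = ‖∑ X, ∑ Y, ∑ i ∈ univ.filter (fun i => blk i = X), ∑ k ∈ univ.filter (fun k => blk k = Y), star (u i) * A i k * v k‖ := by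
          rw [blockForm_eq_sum_blocks A blk u v]
      _ ≤ ∑ X, ∑ Y, βb X Y * Real.sqrt (∑ i ∈ univ.filter (fun i => blk i = X), ‖u i‖ ^ 2) * Real.sqrt (∑ k ∈ univ.filter (fun k => blk k = Y), ‖v k‖ ^ 2) :=
          (norm_sum_le _ _).trans (Finset.sum_le_sum fun X _ => (norm_sum_le _ _).trans (Finset.sum_le_sum fun Y _ => hA X Y u v))
      _ = ∑ X, ∑ Y, 1 * βb X Y * (a X * b Y) := Finset.sum_congr rfl fun X _ => Finset.sum_congr rfl fun Y _ => by rw [ha, hb]; ring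
      _ ≤ _ := h2
  have := le_sq_mul_of_forall_amgm hS₀ hP
  rw [hu] at this
  exact this

/-! ## §3 The block-constant part -/

/-- ★★ **THE BLOCK-CONSTANT PART**: `Σ_b ‖[A,(g_b∘blk)•]v‖² ≤ ℓ²·S₁²·‖v‖²` (`Σ_b (g_bX − g_bY)² ≤ ℓ²dc(X,Y)²`, `Σ_Y dc·β ≤ S₁`). The square of each commutator is the first-order form
`Σ_{X,Y}(g_Y − g_X)F_{XY}([A,ḡ]v, v)`; Cauchy–Schwarz in `b` and the parametrised Schur step absorb `W² ≤ ℓS₁(tW² + t⁻¹‖v‖²)∕2`. [cite: Balaban1985BackgroundPropagators, Thm 3.11 p.416] -/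
theorem sum_normSq_comm_blockConst_le (A : Matrix n n ℂ) (blk : n → β) (g : B → β → ℝ)
    (dc βb : β → β → ℝ) (hβs : ∀ X Y, βb X Y = βb Y X) (hβ0 : ∀ X Y, 0 ≤ βb X Y) (hdcs : ∀ X Y, dc X Y = dc Y X) (hdc0 : ∀ X Y, 0 ≤ dc X Y)
    {ℓ S₁ : ℝ} (hℓ : 0 ≤ ℓ) (hS₁ : 0 ≤ S₁)
    (hLip : ∀ X Y, ∑ b, (g b X - g b Y) ^ 2 ≤ ℓ ^ 2 * dc X Y ^ 2)
    (hA : ∀ (X Y : β) (u w : n → ℂ),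
      ‖∑ i ∈ univ.filter (fun i => blk i = X), ∑ k ∈ univ.filter (fun k => blk k = Y), star (u i) * A i k * w k‖
        ≤ βb X Y * Real.sqrt (∑ i ∈ univ.filter (fun i => blk i = X), ‖u i‖ ^ 2) * Real.sqrt (∑ k ∈ univ.filter (fun k => blk k = Y), ‖w k‖ ^ 2))
    (hS : ∀ X, ∑ Y, dc X Y * βb X Y ≤ S₁) (v : n → ℂ) :
    ∑ b, ∑ i, ‖(A *ᵥ (fun k => ((g b (blk k) : ℝ) : ℂ) * v k)) i - ((g b (blk i) : ℝ) : ℂ) * (A *ᵥ v) i‖ ^ 2 ≤ ℓ ^ 2 * S₁ ^ 2 * ∑ i, ‖v i‖ ^ 2 := by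
  classical
  set fib : β → Finset n := fun X => univ.filter (fun i => blk i = X) with hfib
  set w : B → n → ℂ := fun b i => (A *ᵥ (fun k => ((g b (blk k) : ℝ) : ℂ) * v k)) i - ((g b (blk i) : ℝ) : ℂ) * (A *ᵥ v) i with hw
  set av : β → ℝ := fun X => Real.sqrt (∑ i ∈ fib X, ‖v i‖ ^ 2) with hav
  set ω : β → ℝ := fun X => Real.sqrt (∑ b, ∑ i ∈ fib X, ‖w b i‖ ^ 2) with hω
  set p : B → β → ℝ := fun b X => Real.sqrt (∑ i ∈ fib X, ‖w b i‖ ^ 2) with hp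
  have hav0 : ∀ X, 0 ≤ av X := fun X => Real.sqrt_nonneg _
  have hω0 : ∀ X, 0 ≤ ω X := fun X => Real.sqrt_nonneg _
  have hav2 : ∑ X, av X ^ 2 = ∑ i, ‖v i‖ ^ 2 := by
    rw [sum_eq_sum_blocks blk (fun i => ‖v i‖ ^ 2)]
    exact Finset.sum_congr rfl fun X _ => Real.sq_sqrt (Finset.sum_nonneg fun i _ => sq_nonneg _)
  have hω2 : ∑ X, ω X ^ 2 = ∑ b, ∑ i, ‖w b i‖ ^ 2 := by
    have : ∀ X, ω X ^ 2 = ∑ b, ∑ i ∈ fib X, ‖w b i‖ ^ 2 := fun X =>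
      Real.sq_sqrt (Finset.sum_nonneg fun b _ => Finset.sum_nonneg fun i _ => sq_nonneg _)
    simp only [this]
    rw [Finset.sum_comm]
    exact Finset.sum_congr rfl fun b _ => (sum_eq_sum_blocks blk (fun i => ‖w b i‖ ^ 2)).symm
  have hp2 : ∀ X, ∑ b, p b X ^ 2 = ω X ^ 2 := fun X => by
    have : ∀ b, p b X ^ 2 = ∑ i ∈ fib X, ‖w b i‖ ^ 2 := fun b => Real.sq_sqrt (Finset.sum_nonneg fun i _ => sq_nonneg _)
    simp only [this]
    exact (Real.sq_sqrt (Finset.sum_nonneg fun b _ => Finset.sum_nonneg fun i _ => sq_nonneg _)).symm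
  -- each square is a first-order block form
  have hsq : ∀ b, ∑ i, ‖w b i‖ ^ 2 ≤ ∑ X, ∑ Y, |g b X - g b Y| * (βb X Y * (p b X * av Y)) := by
    intro b
    have hZ : (((∑ i, ‖w b i‖ ^ 2 : ℝ)) : ℂ)
        = ∑ X, ∑ Y, ((g b Y - g b X : ℝ) : ℂ) * ∑ i ∈ fib X, ∑ k ∈ fib Y, star (w b i) * A i k * v k := by
      rw [← sum_star_mul_self_eq]
      have e1 : ∀ i, star (w b i) * w b i = ∑ k, ((g b (blk k) - g b (blk i) : ℝ) : ℂ) * (star (w b i) * A i k * v k) := by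
        intro i
        conv_lhs => arg 2; rw [show w b i = (A *ᵥ (fun k => ((g b (blk k) : ℝ) : ℂ) * v k)) i - ((g b (blk i) : ℝ) : ℂ) * (A *ᵥ v) i from rfl,
          comm_apply]
        rw [Finset.mul_sum]
        exact Finset.sum_congr rfl fun k _ => by push_cast; ring
      simp only [e1]
      exact sum_blockCoeff_mul_eq blk (fun X Y => ((g b Y - g b X : ℝ) : ℂ)) (fun i k => star (w b i) * A i k * v k)
    have h1 : ∑ i, ‖w b i‖ ^ 2 = ‖(((∑ i, ‖w b i‖ ^ 2 : ℝ)) : ℂ)‖ := by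
      rw [Complex.norm_real, Real.norm_eq_abs, abs_of_nonneg (Finset.sum_nonneg fun i _ => sq_nonneg _)]
    rw [h1, hZ]
    refine (norm_sum_le _ _).trans (Finset.sum_le_sum fun X _ => (norm_sum_le _ _).trans (Finset.sum_le_sum fun Y _ => ?_))
    rw [norm_mul, Complex.norm_real, Real.norm_eq_abs, abs_sub_comm]
    refine mul_le_mul_of_nonneg_left ?_ (abs_nonneg _)
    have := hA X Y (w b) v
    rw [mul_assoc] at this
    exact this
  -- Cauchy–Schwarz in `b`
  have hCS : ∀ X Y, ∑ b, |g b X - g b Y| * p b X ≤ ℓ * dc X Y * ω X := by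
    intro X Y
    refine (Real.sum_mul_le_sqrt_mul_sqrt _ _ _).trans ?_
    have h1 : Real.sqrt (∑ b, |g b X - g b Y| ^ 2) ≤ ℓ * dc X Y := by
      rw [← Real.sqrt_sq (mul_nonneg hℓ (hdc0 X Y)), mul_pow]
      exact Real.sqrt_le_sqrt (by simpa only [sq_abs] using hLip X Y)
    have h2 : Real.sqrt (∑ b, p b X ^ 2) = ω X := by rw [hp2, Real.sqrt_sq (hω0 X)]
    rw [h2]
    exact mul_le_mul_of_nonneg_right h1 (hω0 X)
  -- the parametrised absorption
  have hP : ∀ t : ℝ, 0 < t → ∑ b, ∑ i, ‖w b i‖ ^ 2 ≤ (ℓ * S₁) * (t * (∑ b, ∑ i, ‖w b i‖ ^ 2) + t⁻¹ * ∑ i, ‖v i‖ ^ 2) / 2 := by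
    intro t ht
    calc ∑ b, ∑ i, ‖w b i‖ ^ 2 ≤ ∑ b, ∑ X, ∑ Y, |g b X - g b Y| * (βb X Y * (p b X * av Y)) := Finset.sum_le_sum fun b _ => hsq b
      _ = ∑ X, ∑ Y, βb X Y * ((∑ b, |g b X - g b Y| * p b X) * av Y) := by
          rw [Finset.sum_comm]
          refine Finset.sum_congr rfl fun X _ => ?_
          rw [Finset.sum_comm]
          refine Finset.sum_congr rfl fun Y _ => ?_
          rw [Finset.sum_mul, Finset.mul_sum]
          exact Finset.sum_congr rfl fun b _ => by ring
      _ ≤ ∑ X, ∑ Y, βb X Y * ((ℓ * dc X Y * ω X) * av Y) :=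
          Finset.sum_le_sum fun X _ => Finset.sum_le_sum fun Y _ =>
            mul_le_mul_of_nonneg_left (mul_le_mul_of_nonneg_right (hCS X Y) (hav0 Y)) (hβ0 X Y)
      _ = ℓ * ∑ X, ∑ Y, dc X Y * βb X Y * (ω X * av Y) := by
          rw [Finset.mul_sum]; refine Finset.sum_congr rfl fun X _ => ?_
          rw [Finset.mul_sum]; exact Finset.sum_congr rfl fun Y _ => by ring
      _ ≤ ℓ * (S₁ * (t * (∑ X, ω X ^ 2) + t⁻¹ * ∑ X, av X ^ 2) / 2) :=
          mul_le_mul_of_nonneg_left (sum_weighted_prod_le_param dc βb hdcs hβs hdc0 hβ0 hS ω av ht) hℓ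
      _ = (ℓ * S₁) * (t * (∑ b, ∑ i, ‖w b i‖ ^ 2) + t⁻¹ * ∑ i, ‖v i‖ ^ 2) / 2 := by rw [hω2, hav2]; ring
  have hfin := le_sq_mul_of_forall_amgm (mul_nonneg hℓ hS₁) hP
  rw [mul_pow] at hfin
  simpa only [hw] using hfin

/-! ## §4 The in-block oscillation part -/

omit [Fintype B] [Fintype β] [DecidableEq β] in
/-- `‖x − y‖² ≤ 2‖x‖² + 2‖y‖²` summed. [folklore] -/
theorem sum_normSq_sub_le (x y : n → ℂ) : ∑ i, ‖x i - y i‖ ^ 2 ≤ 2 * ∑ i, ‖x i‖ ^ 2 + 2 * ∑ i, ‖y i‖ ^ 2 := by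
  rw [Finset.mul_sum, Finset.mul_sum, ← Finset.sum_add_distrib]
  refine Finset.sum_le_sum fun i _ => ?_
  nlinarith [norm_sub_le (x i) (y i), norm_nonneg (x i - y i), norm_nonneg (x i), norm_nonneg (y i), sq_nonneg (‖x i‖ - ‖y i‖)]

/-- ★★ **THE IN-BLOCK OSCILLATION PART**: `Σ_b ‖[A, δ_b•]v‖² ≤ 4ε²S₀²·‖v‖²` — `[A,δ]v = A(δ•v) − δ•(Av)`, `‖A·‖ ≤ S₀‖·‖`, `Σ_b δ_b(i)² ≤ ε²`. [cite: Balaban1985BackgroundPropagators, Thm 3.11 p.416] -/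
theorem sum_normSq_comm_diag_le (A : Matrix n n ℂ) (blk : n → β) (δ : B → n → ℝ)
    (βb : β → β → ℝ) (hβs : ∀ X Y, βb X Y = βb Y X) (hβ0 : ∀ X Y, 0 ≤ βb X Y) {ε S₀ : ℝ} (hS₀ : 0 ≤ S₀)
    (hδ : ∀ i, ∑ b, δ b i ^ 2 ≤ ε ^ 2)
    (hA : ∀ (X Y : β) (u w : n → ℂ),
      ‖∑ i ∈ univ.filter (fun i => blk i = X), ∑ k ∈ univ.filter (fun k => blk k = Y), star (u i) * A i k * w k‖
        ≤ βb X Y * Real.sqrt (∑ i ∈ univ.filter (fun i => blk i = X), ‖u i‖ ^ 2) * Real.sqrt (∑ k ∈ univ.filter (fun k => blk k = Y), ‖w k‖ ^ 2))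
    (hS : ∀ X, ∑ Y, βb X Y ≤ S₀) (v : n → ℂ) :
    ∑ b, ∑ i, ‖(A *ᵥ (fun k => ((δ b k : ℝ) : ℂ) * v k)) i - ((δ b i : ℝ) : ℂ) * (A *ᵥ v) i‖ ^ 2 ≤ 4 * ε ^ 2 * S₀ ^ 2 * ∑ i, ‖v i‖ ^ 2 := by
  have hop := normSq_mulVec_le_of_blockBound A blk βb hβs hβ0 hS₀ hA hS
  -- first pieces: `Σ_b ‖A(δ_b•v)‖² ≤ S₀² Σ_b ‖δ_b•v‖² ≤ S₀² ε² ‖v‖²`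
  have h1 : ∑ b, ∑ i, ‖(A *ᵥ (fun k => ((δ b k : ℝ) : ℂ) * v k)) i‖ ^ 2 ≤ S₀ ^ 2 * (ε ^ 2 * ∑ i, ‖v i‖ ^ 2) := by
    calc ∑ b, ∑ i, ‖(A *ᵥ (fun k => ((δ b k : ℝ) : ℂ) * v k)) i‖ ^ 2
        ≤ ∑ b, S₀ ^ 2 * ∑ i, ‖((δ b i : ℝ) : ℂ) * v i‖ ^ 2 := Finset.sum_le_sum fun b _ => hop _
      _ = S₀ ^ 2 * ∑ b, ∑ i ∈ (univ : Finset n), ‖((δ b i : ℝ) : ℂ) * v i‖ ^ 2 := by rw [← Finset.mul_sum]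
      _ ≤ S₀ ^ 2 * (ε ^ 2 * ∑ i, ‖v i‖ ^ 2) :=
          mul_le_mul_of_nonneg_left (sum_normSq_diagMul_block_le δ hδ v univ) (sq_nonneg _)
  -- second pieces: `Σ_b ‖δ_b•(Av)‖² ≤ ε² ‖Av‖² ≤ ε² S₀² ‖v‖²`
  have h2 : ∑ b, ∑ i, ‖((δ b i : ℝ) : ℂ) * (A *ᵥ v) i‖ ^ 2 ≤ ε ^ 2 * (S₀ ^ 2 * ∑ i, ‖v i‖ ^ 2) :=
    (sum_normSq_diagMul_block_le δ hδ (A *ᵥ v) univ).trans (mul_le_mul_of_nonneg_left (hop v) (sq_nonneg _))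
  calc ∑ b, ∑ i, ‖(A *ᵥ (fun k => ((δ b k : ℝ) : ℂ) * v k)) i - ((δ b i : ℝ) : ℂ) * (A *ᵥ v) i‖ ^ 2
      ≤ ∑ b, (2 * ∑ i, ‖(A *ᵥ (fun k => ((δ b k : ℝ) : ℂ) * v k)) i‖ ^ 2 + 2 * ∑ i, ‖((δ b i : ℝ) : ℂ) * (A *ᵥ v) i‖ ^ 2) :=
        Finset.sum_le_sum fun b _ => sum_normSq_sub_le _ _
    _ = 2 * ∑ b, ∑ i, ‖(A *ᵥ (fun k => ((δ b k : ℝ) : ℂ) * v k)) i‖ ^ 2 + 2 * ∑ b, ∑ i, ‖((δ b i : ℝ) : ℂ) * (A *ᵥ v) i‖ ^ 2 := by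
        rw [Finset.sum_add_distrib, Finset.mul_sum, Finset.mul_sum]
    _ ≤ 4 * ε ^ 2 * S₀ ^ 2 * ∑ i, ‖v i‖ ^ 2 := by nlinarith [h1, h2]

/-! ## §5 The perturbed family -/

/-- ★★★ **THE FIRST-ORDER COMMUTATOR OF A BLOCK-BILINEARLY BOUNDED KERNEL WITH A PERTURBED BLOCK-LIPSCHITZ FAMILY**: cut-offs `h_b = g_b∘blk + δ_b` with
`Σ_b (g_bX − g_bY)² ≤ ℓ²dc(X,Y)²`, `Σ_b δ_b(i)² ≤ ε²`; kernel with block bilinear bounds `β` (symmetric `≥ 0`), `Σ_Y β ≤ S₀`, `Σ_Y dc·β ≤ S₁`: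
`Σ_b ‖A(h_b•v) − h_b•(Av)‖² ≤ (2ℓ²S₁² + 8ε²S₀²)·‖v‖²` — the abstract core of the knit's slot `hK₂` (the `[P,χ′](D*A)` piece). [cite: Balaban1985BackgroundPropagators, (3.49) p.399, Thm 3.11 p.416] -/
theorem sum_normSq_comm_le_of_blockBound_perturbed (A : Matrix n n ℂ) (blk : n → β) (g : B → β → ℝ) (δ : B → n → ℝ)
    (dc βb : β → β → ℝ) (hβs : ∀ X Y, βb X Y = βb Y X) (hβ0 : ∀ X Y, 0 ≤ βb X Y) (hdcs : ∀ X Y, dc X Y = dc Y X) (hdc0 : ∀ X Y, 0 ≤ dc X Y)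
    {ℓ ε S₀ S₁ : ℝ} (hℓ : 0 ≤ ℓ) (hS₀ : 0 ≤ S₀) (hS₁ : 0 ≤ S₁)
    (hLip : ∀ X Y, ∑ b, (g b X - g b Y) ^ 2 ≤ ℓ ^ 2 * dc X Y ^ 2) (hδ : ∀ i, ∑ b, δ b i ^ 2 ≤ ε ^ 2)
    (hA : ∀ (X Y : β) (u w : n → ℂ),
      ‖∑ i ∈ univ.filter (fun i => blk i = X), ∑ k ∈ univ.filter (fun k => blk k = Y), star (u i) * A i k * w k‖
        ≤ βb X Y * Real.sqrt (∑ i ∈ univ.filter (fun i => blk i = X), ‖u i‖ ^ 2) * Real.sqrt (∑ k ∈ univ.filter (fun k => blk k = Y), ‖w k‖ ^ 2))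
    (hS0 : ∀ X, ∑ Y, βb X Y ≤ S₀) (hS1 : ∀ X, ∑ Y, dc X Y * βb X Y ≤ S₁) (v : n → ℂ) :
    ∑ b, ∑ i, ‖(A *ᵥ (fun k => ((g b (blk k) + δ b k : ℝ) : ℂ) * v k)) i - ((g b (blk i) + δ b i : ℝ) : ℂ) * (A *ᵥ v) i‖ ^ 2
      ≤ (2 * ℓ ^ 2 * S₁ ^ 2 + 8 * ε ^ 2 * S₀ ^ 2) * ∑ i, ‖v i‖ ^ 2 := by
  have hg := sum_normSq_comm_blockConst_le A blk g dc βb hβs hβ0 hdcs hdc0 hℓ hS₁ hLip hA hS1 v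
  have hd := sum_normSq_comm_diag_le A blk δ βb hβs hβ0 hS₀ hδ hA hS0 v
  -- the commutator is additive in the cut-off
  have e : ∀ b i, (A *ᵥ (fun k => ((g b (blk k) + δ b k : ℝ) : ℂ) * v k)) i - ((g b (blk i) + δ b i : ℝ) : ℂ) * (A *ᵥ v) i
      = ((A *ᵥ (fun k => ((g b (blk k) : ℝ) : ℂ) * v k)) i - ((g b (blk i) : ℝ) : ℂ) * (A *ᵥ v) i)
        - -((A *ᵥ (fun k => ((δ b k : ℝ) : ℂ) * v k)) i - ((δ b i : ℝ) : ℂ) * (A *ᵥ v) i) := by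
    intro b i
    rw [comm_apply, comm_apply, comm_apply, sub_neg_eq_add, ← Finset.sum_add_distrib]
    exact Finset.sum_congr rfl fun k _ => by push_cast; ring
  simp only [e]
  calc ∑ b, ∑ i, ‖((A *ᵥ (fun k => ((g b (blk k) : ℝ) : ℂ) * v k)) i - ((g b (blk i) : ℝ) : ℂ) * (A *ᵥ v) i)
        - -((A *ᵥ (fun k => ((δ b k : ℝ) : ℂ) * v k)) i - ((δ b i : ℝ) : ℂ) * (A *ᵥ v) i)‖ ^ 2
      ≤ ∑ b, (2 * ∑ i, ‖(A *ᵥ (fun k => ((g b (blk k) : ℝ) : ℂ) * v k)) i - ((g b (blk i) : ℝ) : ℂ) * (A *ᵥ v) i‖ ^ 2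
          + 2 * ∑ i, ‖-((A *ᵥ (fun k => ((δ b k : ℝ) : ℂ) * v k)) i - ((δ b i : ℝ) : ℂ) * (A *ᵥ v) i)‖ ^ 2) :=
        Finset.sum_le_sum fun b _ => sum_normSq_sub_le _ _
    _ = 2 * ∑ b, ∑ i, ‖(A *ᵥ (fun k => ((g b (blk k) : ℝ) : ℂ) * v k)) i - ((g b (blk i) : ℝ) : ℂ) * (A *ᵥ v) i‖ ^ 2
          + 2 * ∑ b, ∑ i, ‖(A *ᵥ (fun k => ((δ b k : ℝ) : ℂ) * v k)) i - ((δ b i : ℝ) : ℂ) * (A *ᵥ v) i‖ ^ 2 := by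
        simp only [norm_neg, Finset.sum_add_distrib, Finset.mul_sum]
    _ ≤ (2 * ℓ ^ 2 * S₁ ^ 2 + 8 * ε ^ 2 * S₀ ^ 2) * ∑ i, ‖v i‖ ^ 2 := by nlinarith [hg, hd]

/-! ## §6 Adjacent-step rows ⟹ all-pairs rows along a path (how the member feeds `hLip`) -/

omit [Fintype n] [Fintype β] [DecidableEq β] in
/-- **PATH FORM OF THE COARSE LIPSCHITZ ROW**: if every ADJACENT pair carries the family row `Σ_b (g_b Z − g_b Z′)² ≤ B` (pen (L6-χ)'s ✓`sum_sq_corner_shift_sub_le`, one coarse step), then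
along any path `p 0, p 1, …, p m` of adjacent points `Σ_b (g_b(p 0) − g_b(p m))² ≤ m²·B` (telescoping + Cauchy–Schwarz) — so `hLip` of §3∕§5 and of ✓p749039∕✓p750965 holds with
`ℓ² := B` and `dc X Y :=` the length of a shortest adjacent path (the coarse torus distance `tdist`). [folklore] -/
theorem sum_sq_sub_le_of_path (g : B → β → ℝ) (adj : β → β → Prop) {Bst : ℝ}
    (hadj : ∀ Z Z', adj Z Z' → ∑ b, (g b Z - g b Z') ^ 2 ≤ Bst) (p : ℕ → β) (m : ℕ)
    (hp : ∀ s < m, adj (p s) (p (s + 1))) :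
    ∑ b, (g b (p 0) - g b (p m)) ^ 2 ≤ (m : ℝ) ^ 2 * Bst := by
  have htel : ∀ b, g b (p 0) - g b (p m) = ∑ s ∈ Finset.range m, (g b (p s) - g b (p (s + 1))) := fun b =>
    (Finset.sum_range_sub' (fun s => g b (p s)) m).symm
  calc ∑ b, (g b (p 0) - g b (p m)) ^ 2
      = ∑ b, (∑ s ∈ Finset.range m, (g b (p s) - g b (p (s + 1))) * 1) ^ 2 := by
        refine Finset.sum_congr rfl fun b _ => ?_; rw [htel b]; simp only [mul_one]
    _ ≤ ∑ b, (∑ s ∈ Finset.range m, (g b (p s) - g b (p (s + 1))) ^ 2) * ∑ s ∈ Finset.range m, (1 : ℝ) ^ 2 :=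
        Finset.sum_le_sum fun b _ => Finset.sum_mul_sq_le_sq_mul_sq _ _ _
    _ = (m : ℝ) * ∑ s ∈ Finset.range m, ∑ b, (g b (p s) - g b (p (s + 1))) ^ 2 := by
        rw [Finset.sum_comm, ← Finset.sum_mul]; simp only [one_pow, Finset.sum_const, Finset.card_range, nsmul_eq_mul, mul_one]; ring
    _ ≤ (m : ℝ) * ∑ s ∈ Finset.range m, Bst :=
        mul_le_mul_of_nonneg_left (Finset.sum_le_sum fun s hs => hadj _ _ (hp s (Finset.mem_range.1 hs))) (Nat.cast_nonneg _)
    _ = (m : ℝ) ^ 2 * Bst := by rw [Finset.sum_const, Finset.card_range, nsmul_eq_mul]; ring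

end Summit.QuantumFields.YangMills.Theorems.Prop7IMSFirstOrderBlockCommutator

end
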